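import Mathlib
import HarnessLib
import Literature.MathematicalPhysics.KineticTheory.VelocityFlipNoise
import Summits.AtomisticToContinuum.FouriersLaw.Theorems.VanishingNoiseTransferVanishingNoiseBoundNoisyKuboLink

/-!
# Classical forward fields of the flip-noisy equilibrium generator are unique up to additive constants

`--supports stmt-AtomisticToContinuum-11976` helper file (crux `VanishingNoiseBound`, route
`VanishingNoiseTransfer`, line `fekete-usc-one-length`, stub S3' `stub_flipForwardFieldRegularity`, wave 4).
Companion of the dual Kubo road (`…FlipDualAssembly`: S3 from `HYPO` + `CONT`): the residual `CONT` (continuity at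
`δ = 0` of the Gibbs pairings of the mild forward family) can alternatively be attacked by compactness + UNIQUENESS at
equilibrium; this file supplies the uniqueness. For the pinned chain (all parameters `> 0`), `T > 0`, `ε > 0`, `L ≥ 2`:

* `flip_forwardField_unique` — two classical forward fields `g, g' ∈ C² ∩ L²(μ_T)` of `L_{T,T} + εS` with the same
  source `−(p_0² − T)` differ by a constant. Proof: `d = g − g'` solves `(L_{T,T} + εS) d = 0`, i.e. `(d, εSd)` is a
  plain forward PAIR (`flip_forwardPair`); fluctuation–dissipation (`fluctuation_dissipation`, crux 11748) gives
  `γT(‖∂_{p_0}d‖² + ‖∂_{p_{L−1}}d‖²) + (ε/2) Σ_i ‖d∘F_i − d‖² = 0`, so `d` is flip invariant, `Sd ≡ 0`, `L_{T,T} d = 0`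
  classically, and `d −` mean is absorbed by the uniqueness of PLAIN forward fields (`plainForwardField_unique'`).
* `helper_flipForwardFieldUnique` — registered helper (notation-free restatement).
-/

noncomputable section

open MeasureTheory Filter Topology
open scoped ContDiff
open Literature.MathematicalPhysics.KineticTheory.HeatConduction
open Summit.AtomisticToContinuum.FouriersLaw.Theorems.SuperadditiveResistance.DeviceLiouville
  (kin kin_eq_sq liouvilleOp bathOp liouvilleOp_sub bathOp_sub)
open Summit.AtomisticToContinuum.FouriersLaw.Theorems.SuperadditiveResistance.Kubo
  (termWeight termWeight_nonneg termWeight_pos sum_termWeight_mul memLp_partialP fluctuation_dissipation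
    memLp_kinetic partition_pos)
open Summit.AtomisticToContinuum.FouriersLaw.Theorems.SuperadditiveResistance.KuboPlain
  (generator_eq_liouvilleOp_add_bathOp bathFin bathFin_zero bathFin_one bathFin_injective bathWeight_eq_termWeight)
open Summit.AtomisticToContinuum.FouriersLaw.Cruxes.SuperadditiveResistance.FloatingProbeBypassLaplacian
  (plainForwardField_unique')
open Summit.AtomisticToContinuum.FouriersLaw.Cruxes.ConductanceLowerBound.ForecastSensitivity
  (exists_forwardField_ae_eq_poissonField)

namespace Summit.AtomisticToContinuum.FouriersLaw.Theorems.VanishingNoiseBound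

section Unique

variable {ω₂ lam β γ : ℝ}

/-- The equilibrium generator is linear (subtraction) on `C²`. -/
theorem generator_sub' (P : OscillatorChain) (L : ℕ) (T : ℝ) {f g : PhaseSpace L → ℝ} (hf : ContDiff ℝ 2 f)
    (hg : ContDiff ℝ 2 g) (x : PhaseSpace L) :
    P.generator L T T (fun y => f y - g y) x = P.generator L T T f x - P.generator L T T g x := by
  rw [generator_eq_liouvilleOp_add_bathOp, generator_eq_liouvilleOp_add_bathOp, generator_eq_liouvilleOp_add_bathOp,
    liouvilleOp_sub (hf.differentiable two_ne_zero) (hg.differentiable two_ne_zero), bathOp_sub hf hg]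
  ring

/-- **Classical flip forward fields are unique up to additive constants.** See the module docstring. -/
theorem flip_forwardField_unique (hω : 0 < ω₂) (hl : 0 < lam) (hβ : 0 < β) (hγ : 0 < γ) {T : ℝ} (hT : 0 < T)
    {ε : ℝ} (hε : 0 < ε) {L : ℕ} (hL : 2 ≤ L) {g g' : PhaseSpace L → ℝ}
    (hg2 : ContDiff ℝ 2 g) (hgL : MemLp g 2 ((pinnedChain ω₂ lam β γ).gibbsMeasure L T))
    (hpde : ∀ x, (pinnedChain ω₂ lam β γ).flipGenerator L T T ε g x = -(kin L 0 x - T))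
    (hg2' : ContDiff ℝ 2 g') (hgL' : MemLp g' 2 ((pinnedChain ω₂ lam β γ).gibbsMeasure L T))
    (hpde' : ∀ x, (pinnedChain ω₂ lam β γ).flipGenerator L T T ε g' x = -(kin L 0 x - T)) :
    ∃ c : ℝ, ∀ x, g x = g' x + c := by
  have hL1 : 1 ≤ L := by omega
  have hL0 : 0 < L := by omega
  set P := pinnedChain ω₂ lam β γ with hP
  set μ := P.gibbsMeasure L T with hμ
  haveI : IsProbabilityMeasure μ := pinnedChain_isProbabilityMeasure_gibbsMeasure hω hl.le hβ.le γ L hT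
  have hflip := gibbs_flipInvariant (ω₂ := ω₂) (lam := lam) (β := β) (γ := γ) L T
  set i0 : Fin L := ⟨0, hL0⟩ with hi0
  set i1 : Fin L := ⟨L - 1, by omega⟩ with hi1
  set s := bathFin L hL1 with hs_def
  have hs : Function.Injective s := bathFin_injective hL
  have hs0 : s 0 = i0 := bathFin_zero hL1
  have hs1 : s 1 = i1 := bathFin_one hL1
  have hBw : OscillatorChain.bathWeight L = termWeight s := bathWeight_eq_termWeight hL
  -- the difference `d` solves the homogeneous equation
  set d : PhaseSpace L → ℝ := fun x => g x - g' x with hd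
  have hd2 : ContDiff ℝ 2 d := hg2.sub hg2'
  have hdL : MemLp d 2 μ := hgL.sub hgL'
  have hpded : ∀ x, P.flipGenerator L T T ε d x = -(0 : ℝ) := by
    intro x
    have e : P.flipGenerator L T T ε d x = P.flipGenerator L T T ε g x - P.flipGenerator L T T ε g' x := by
      rw [hd, OscillatorChain.flipGenerator_eq_add_flipNoise, OscillatorChain.flipGenerator_eq_add_flipNoise,
        OscillatorChain.flipGenerator_eq_add_flipNoise, generator_sub' P L T hg2 hg2']
      have hS : flipNoise L (fun y => g y - g' y) x = flipNoise L g x - flipNoise L g' x := by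
        simp only [flipNoise_eq, Finset.sum_sub_distrib]; ring
      rw [hS]; ring
    rw [e, hpde x, hpde' x]; ring
  -- `(d, εSd)` is a plain forward pair
  set k' : PhaseSpace L → ℝ := fun x => 0 + ε * flipNoise L d x with hk'
  have hpair : ∀ x, (1 : ℝ) * liouvilleOp P L d x + γ * bathOp L (termWeight s) T d x = -k' x := by
    intro x
    rw [← hBw]
    exact flip_forwardPair (ω₂ := ω₂) (lam := lam) (β := β) (γ := γ) L T ε (k := fun _ => (0 : ℝ)) hpded x
  have hSdL2 : MemLp (flipNoise L d) 2 μ := memLp_flipNoise hflip hdL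
  have hk'L2 : MemLp k' 2 μ := by
    have : k' = fun x => ε * flipNoise L d x := by funext x; rw [hk']; ring
    rw [this]; exact hSdL2.const_mul ε
  have hB0 : ∀ i, 0 ≤ termWeight s i := termWeight_nonneg s
  -- fluctuation–dissipation: `∫ d k' dμ = γT(D0 + D1) ≥ 0`, while `∫ d k' = ε ∫ d Sd = −(ε/2) E ≤ 0`
  set D0 : ℝ := ∫ x, partialP i0 d x ^ 2 ∂μ with hD0
  set D1 : ℝ := ∫ x, partialP i1 d x ^ 2 ∂μ with hD1
  have hD0n : 0 ≤ D0 := integral_nonneg fun x => sq_nonneg _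
  have hD1n : 0 ≤ D1 := integral_nonneg fun x => sq_nonneg _
  have hZ : 0 < ∫ x, P.gibbsDensity L T x := partition_pos hω hl.le hβ.le L hT
  have hFD : ∫ x, d x * k' x ∂μ = γ * T * (D0 + D1) := by
    have h := fluctuation_dissipation hω hl.le hβ.le L hT (termWeight s) hB0 1 hγ hd2 hdL hk'L2 hpair
    rw [sum_termWeight_mul s, Fin.sum_univ_two, hs0, hs1] at h
    rw [P.integral_gibbsMeasure, h, hD0, hD1, P.integral_gibbsMeasure, P.integral_gibbsMeasure]
    field_simp
    rfl
  set E : ℝ := ∑ i, ∫ x, (d (momentumFlip i x) - d x) ^ 2 ∂μ with hE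
  have hEn : 0 ≤ E := flipDirichlet_nonneg d
  have hdS : ∫ x, d x * flipNoise L d x ∂μ = -(1 / 2) * E := integral_mul_flipNoise_self hflip hdL
  have hFD' : ∫ x, d x * k' x ∂μ = -(ε / 2) * E := by
    have e : (fun x => d x * k' x) = fun x => ε * (d x * flipNoise L d x) := by funext x; rw [hk']; ring
    rw [e, integral_const_mul, hdS]; ring
  have hE0 : E = 0 := by
    have h1 : γ * T * (D0 + D1) = -(ε / 2) * E := by rw [← hFD, hFD']
    have h2 : 0 ≤ γ * T * (D0 + D1) := by positivity
    nlinarith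
  -- hence `d` is flip invariant and `L_{T,T} d = 0` classically
  have hzero : ∀ i x, d (momentumFlip i x) - d x = 0 := by
    intro i
    have hdi : MemLp (fun x => d (momentumFlip i x)) 2 μ := memLp_comp_momentumFlip hflip hdL i
    have hint : Integrable (fun x => (d (momentumFlip i x) - d x) ^ 2) μ := (hdi.sub hdL).integrable_sq
    have hEi : ∫ x, (d (momentumFlip i x) - d x) ^ 2 ∂μ = 0 := by
      have hle : ∫ x, (d (momentumFlip i x) - d x) ^ 2 ∂μ ≤ E := by
        rw [hE]
        exact Finset.single_le_sum (f := fun j => ∫ x, (d (momentumFlip j x) - d x) ^ 2 ∂μ)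
          (fun j _ => integral_nonneg fun x => sq_nonneg _) (Finset.mem_univ i)
      have hge : 0 ≤ ∫ x, (d (momentumFlip i x) - d x) ^ 2 ∂μ := integral_nonneg fun x => sq_nonneg _
      linarith
    have hae : (fun x => (d (momentumFlip i x) - d x) ^ 2) =ᵐ[μ] 0 :=
      (integral_eq_zero_iff_of_nonneg (fun x => sq_nonneg _) hint).1 hEi
    have hcont : Continuous fun x => (d (momentumFlip i x) - d x) ^ 2 :=
      ((hd2.continuous.comp (continuous_momentumFlip i)).sub hd2.continuous).pow 2
    have hvol : (fun x => (d (momentumFlip i x) - d x) ^ 2) =ᵐ[volume] 0 := by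
      have hρ : Integrable (P.gibbsDensity L T) := pinnedChain_integrable_gibbsDensity hω hl.le hβ.le γ L hT
      have hac : (volume : Measure (PhaseSpace L)) ≪ μ := by
        rw [hμ, OscillatorChain.gibbsMeasure_eq]
        exact absolutelyContinuous_tilted hρ
      exact hac.ae_le hae
    have heq := (hcont.ae_eq_iff_eq volume continuous_const).1 hvol
    intro x
    have h2 : (d (momentumFlip i x) - d x) ^ 2 = 0 := congr_fun heq x
    exact pow_eq_zero_iff (n := 2) (by norm_num) |>.1 h2
  have hS0 : ∀ x, flipNoise L d x = 0 := fun x => by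
    rw [flipNoise_eq]; exact Finset.sum_eq_zero fun i _ => hzero i x
  have hplain : ∀ x, P.generator L T T d x = 0 := by
    intro x; have h := hpded x
    rw [OscillatorChain.flipGenerator_eq_add_flipNoise, hS0 x, mul_zero, add_zero, neg_zero] at h
    exact h
  -- `d − m` is absorbed by a plain forward field: uniqueness of plain forward fields
  set m : ℝ := ∫ x, d x ∂μ with hm
  obtain ⟨gs, hgs, hgsL, hgsm, hgspde, -⟩ := exists_forwardField_ae_eq_poissonField hω hl.le hβ hγ hL0 hT
  have hgs2 : ContDiff ℝ 2 gs := hgs.of_le (by norm_cast)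
  have hgspde' : ∀ x, P.generator L T T gs x = -(kin L 0 x - T) := fun x => by rw [hgspde x, kin_eq_sq hL0]
  have hsum2 : ContDiff ℝ 2 (fun x => gs x + (d x - m)) := hgs2.add (hd2.sub contDiff_const)
  have hsumL : MemLp (fun x => gs x + (d x - m)) 2 μ := hgsL.add (hdL.sub (memLp_const m))
  have hsumm : ∫ x, (gs x + (d x - m)) ∂μ = 0 := by
    have i1 : Integrable gs μ := hgsL.integrable one_le_two
    have i2 : Integrable (fun x => d x - m) μ := (hdL.integrable one_le_two).sub (integrable_const m)
    rw [integral_add i1 i2, integral_sub (hdL.integrable one_le_two) (integrable_const m), integral_const,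
      probReal_univ, one_smul]
    show (∫ x, gs x ∂μ) + ((∫ x, d x ∂μ) - m) = 0
    rw [hgsm, hm]; ring
  have hsumpde : ∀ x, P.generator L T T (fun x => gs x + (d x - m)) x = -(kin L 0 x - T) := by
    intro x
    have hw : ContDiff ℝ 2 (fun y => m - d y) := contDiff_const.sub hd2
    have e1 : (fun x => gs x + (d x - m)) = fun x => gs x - (m - d x) := by funext y; ring
    have e2 : P.generator L T T (fun y => m - d y) x = 0 := by
      rw [generator_sub' P L T contDiff_const hd2, hplain x, OscillatorChain.generator_const]; ring
    rw [e1, generator_sub' P L T hgs2 hw, e2, hgspde' x]; ring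
  have heq := plainForwardField_unique' hω hl.le hβ.le hγ hL0 hT 0 hsum2 hsumL hsumm hsumpde hgs2 hgsL hgsm hgspde'
  refine ⟨m, fun x => ?_⟩
  have h := congr_fun heq x
  simp only [hd] at h
  linarith

end Unique

/-! ## Registered helper -/

/-- Registered helper sub-goal `helper_flipForwardFieldUnique` of stub `stub_flipForwardFieldRegularity` (line
`fekete-usc-one-length`, crux stmt-AtomisticToContinuum-11976): classical flip forward fields are unique up to additive
constants (`flip_forwardField_unique`). -/
theorem helper_flipForwardFieldUnique : ∀ (ω₂ lam β γ T ε : ℝ), 0 < ω₂ → 0 < lam → 0 < β → 0 < γ → 0 < T → 0 < ε → ∀ (L : ℕ), 2 ≤ L → ∀ (g g' : Literature.MathematicalPhysics.KineticTheory.HeatConduction.PhaseSpace L → ℝ), ContDiff ℝ 2 g → MeasureTheory.MemLp g 2 ((Literature.MathematicalPhysics.KineticTheory.HeatConduction.pinnedChain ω₂ lam β γ).gibbsMeasure L T) → (∀ x, (Literature.MathematicalPhysics.KineticTheory.HeatConduction.pinnedChain ω₂ lam β γ).flipGenerator L T T ε g x = -(Summit.AtomisticToContinuum.FouriersLaw.Theorems.SuperadditiveResistance.DeviceLiouville.kin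 L 0 x - T)) → ContDiff ℝ 2 g' → MeasureTheory.MemLp g' 2 ((Literature.MathematicalPhysics.KineticTheory.HeatConduction.pinnedChain ω₂ lam β γ).gibbsMeasure L T) → (∀ x, (Literature.MathematicalPhysics.KineticTheory.HeatConduction.pinnedChain ω₂ lam β γ).flipGenerator L T T ε g' x = -(Summit.AtomisticToContinuum.FouriersLaw.Theorems.SuperadditiveResistance.DeviceLiouville.kin L 0 x - T)) → ∃ c : ℝ, ∀ x, g x = g' x + c :=
  fun _ _ _ _ _ _ hω hl hβ hγ hT hε _ hL _ _ hg2 hgL hpde hg2' hgL' hpde' =>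
    flip_forwardField_unique hω hl hβ hγ hT hε hL hg2 hgL hpde hg2' hgL' hpde'

end Summit.AtomisticToContinuum.FouriersLaw.Theorems.VanishingNoiseBound

end
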